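import Mathlib
import Summits.Ventures.DiscreteObjects.Mahler.GraeffeIdentity
import Summits.Ventures.DiscreteObjects.Mahler.Height1CellSymmetry
import Summits.Ventures.DiscreteObjects.Mahler.LehmerExactMeasure
import Summits.Ventures.DiscreteObjects.Mahler.CensusData20to22

/-!
# The two imprimitive degree-20 census entries are Lehmer's polynomial in `±x²` (venture `DiscreteObjects`, target L)

Cell `pub-namedobj`, seat `pub-namedobj-mahler` (gen 11). Framing: lottery ticket; floor = certified
bounds/negative ranges.

The degree-20 census row (`CensusData20to22.coresDeg20`, 49 cores) contains two imprimitive entries of measure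
`λ₀ = M(ℓ) = 1.17628…`: `c20_37 = ℓ(x²)` and `c20_36 = ℓ(-x²)`, where `ℓ = lehmerPoly` is Lehmer's polynomial.  Their
measures are EXACTLY Lehmer's measure (`M(P(x²)) = M(P)`, `M(P(-x)) = M(P)`), which is why `coresDeg20_min`
(`CensusRows20Kernel`) excludes them from the comparison with the primitive minimum `M₂₀ = 1.21282418…` of MRW08 Table 1.
-/

namespace Summit.Ventures.DiscreteObjects.Mahler

open Polynomial

/-- `c20_37 = ℓ(x²)`. -/
theorem ofCoeffs_c20_37_eq : ofCoeffs c20_37 = lehmerPoly.comp (X ^ 2) := by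
  unfold ofCoeffs c20_37 lehmerPoly
  simp [List.zipIdx]
  ring

/-- `c20_36 = ℓ(-x²) = (ℓ(-x))(x²)`. -/
theorem ofCoeffs_c20_36_eq : ofCoeffs c20_36 = (lehmerPoly.comp (-X)).comp (X ^ 2) := by
  unfold ofCoeffs c20_36 lehmerPoly
  simp [List.zipIdx]
  ring

/-- **`M(c20_37) = M(ℓ) = λ₀`** exactly. -/
theorem c20_37_measure_eq_lehmer : intMahlerMeasure (ofCoeffs c20_37) = intMahlerMeasure lehmerPoly := by
  rw [ofCoeffs_c20_37_eq, intMahlerMeasure_comp_X_pow_two]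

/-- **`M(c20_36) = M(ℓ) = λ₀`** exactly. -/
theorem c20_36_measure_eq_lehmer : intMahlerMeasure (ofCoeffs c20_36) = intMahlerMeasure lehmerPoly := by
  rw [ofCoeffs_c20_36_eq, intMahlerMeasure_comp_X_pow_two, intMahlerMeasure_comp_neg_X]

/-- The two lifts have Lehmer's measure to 12 digits (from `lehmer_measure_enclosure`). -/
theorem c20_lehmerLifts_measure_enclosure :
    ((1176280818259 / 10 ^ 12 : ℝ) < intMahlerMeasure (ofCoeffs c20_36) ∧
        intMahlerMeasure (ofCoeffs c20_36) < 1176280818260 / 10 ^ 12) ∧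
      ((1176280818259 / 10 ^ 12 : ℝ) < intMahlerMeasure (ofCoeffs c20_37) ∧
        intMahlerMeasure (ofCoeffs c20_37) < 1176280818260 / 10 ^ 12) := by
  rw [c20_36_measure_eq_lehmer, c20_37_measure_eq_lehmer]
  exact ⟨lehmer_measure_enclosure, lehmer_measure_enclosure⟩

end Summit.Ventures.DiscreteObjects.Mahler
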